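import Summits.Ventures.YMGap.RobustBall.PlaquetteUpperMoment
import Summits.Ventures.YMGap.RobustBall.PlaquetteLeadingCoefficient
import Summits.Ventures.YMGap.RobustBall.HaarSecondMoments
import HarnessLib

/-!
# Robust ball (Y2), area-law side — THE MEAN-PLAQUETTE LAW: `W_μ(1,1) = u · e^{O(β)}` for every limit state, two-sided

HONEST FRAMING: venture file of the cell `pub-ymgap` (QuantumFields programme), track ROBUST-BALL, seat rb-p2 (g6).  LATTICE
statements about the infinite-volume limit states (`infiniteVolumeLimitPoints`) of the `SU(N)` torus Wilson states at tree coupling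
`β` (`= β_W/N`), valid at EVERY `β > 0`, with no expansion and no reflection positivity.  WHAT IS NEW.  The plaquette expectation
`W_μ(1,1) = ⟨(1/N) Re tr U_p⟩_μ` of EVERY limit state is pinned to the leading strong-coupling term `u = βV₀/N` (`β_W/4` for `SU(2)`,
`β_W/(2N²)` for `N ≥ 3`) from BOTH sides with certified `O(β)` exponents:
* lower (`PlaquetteLeadingCoefficient.rectExpectation_one_one_ge_linear`): `W_μ(1,1) ≥ u · e^{−2(d−1)(2d+1)Nβ}`;
* ★ upper (`rectExpectation_one_one_le_exp`, from `PlaquetteUpperMoment`): `W_μ(1,1) ≤ u · e^{8(d−1)²Nβ}`;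
* ★★ hence `|log W_μ(1,1) − log u| = O(β)` uniformly over the limit states (`log_rectExpectation_two_sided`):
  `SU(2)`, `d = 4`: `−54β_W ≤ log W_μ(1,1) − log(β_W/4) ≤ 72β_W` at EVERY `β_W > 0` (`su2_log_plaquette_two_sided_dim4`),
  and `W_μ(1,1)/(β_W/4) → 1` as `β_W → 0` uniformly in `μ` (`su2_plaquette_ratio_limit_dim4`, `ε–β₀` form);
  every `N ≥ 3`, `d = 4`: `−54Nβ ≤ log W_μ(1,1) − log(β/(2N)) ≤ 72Nβ` (`suN_log_plaquette_two_sided_dim4`).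
WHAT IT IS NOT: the `O(β)` exponents are one-link artefacts (the series `W = u + O(u⁵)` is not claimed); nothing continuum /
spectral / Clay.  0 compute.

References: K. Wilson, Phys. Rev. D 10 (1974) 2445; M. Creutz, *Quarks, gluons and lattices* (1983) §8–§10 (for comparison only);
E. Seiler, LNP 159 (1982) §2.  Everything here is proved. [folklore]
-/

noncomputable section

open MeasureTheory Filter Topology Finset
open Literature.MathematicalPhysics.QuantumLattice
open Literature.MathematicalPhysics.QuantumFieldTheory hiding ZdEdge Site

namespace Summit.Ventures.YMGap.RobustBall

namespace PlaquetteLaw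

/-! ### Every compact `G ≅ SU(N)`: the plaquette of a limit state from above -/

section Model

variable {d N : ℕ} [NeZero d] {G : Type*} [Group G] [TopologicalSpace G] [IsTopologicalGroup G]
  [CompactSpace G] [MeasurableSpace G] [BorelSpace G] [SecondCountableTopology G] [T2Space G]
  (ρ : G →* Matrix (Fin N) (Fin N) ℂ)

/-- **The plaquette of a limit state from above**: for `G ≅ SU(N)`, `N ≥ 2`, `d ≥ 2`, every `β ≥ 0` and every infinite-volume limit
point `μ` of the torus Wilson states, with `D = 4(d−1)Nβ`,
`∫ Re tr ρ(U_p) dμ ≤ β e^{D} V₀ (1 + (2(d−1) − 1)(e^{D} − 1))` for the plaquette at the origin of the `(0,1)` plane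
(`PlaquetteUpperMoment.integral_sum_plaquetteObs_le` at the link `(0,0)`, shared equally by the `2(d−1)` plaquettes through it,
`PlaquettePositivity.integral_plaquetteObs_eq`). [folklore] -/
theorem integral_plaquetteObs_le (hρ : IsSpecialUnitaryModel ρ) (hN : 2 ≤ N) (hd : 2 ≤ d) {β : ℝ} (hβ : 0 ≤ β)
    {μ : Measure (LGConfig d G)} (hμ : μ ∈ infiniteVolumeLimitPoints ρ β) :
    ∫ U, plaquetteObs ρ 0 0 1 U ∂μ ≤
      β * Real.exp (4 * ((d : ℝ) - 1) * N * β) * PlaquetteLowerBound.charVariance ρ *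
        (1 + (2 * ((d : ℝ) - 1) - 1) * (Real.exp (4 * ((d : ℝ) - 1) * N * β) - 1)) := by
  have hG : μ ∈ ymGibbsMeasures ρ β := mem_ymGibbsMeasures_of_mem_infiniteVolumeLimitPoints_holds ρ hρ.1 hμ
  obtain ⟨φ, hφ, hprob, hconv⟩ := id hμ
  haveI := hprob
  set e₀ : Literature.MathematicalPhysics.QuantumLattice.ZdEdge d :=
    ((0 : Literature.Probability.LatticeModels.Site d), (0 : Fin d)) with he₀
  have h := PlaquetteUpperMoment.integral_sum_plaquetteObs_le ρ hρ hN hd hβ hG e₀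
  have hsum : ∫ U, ∑ p ∈ plaquettesTouching {e₀}, plaquetteObs ρ p.1 p.2.1.1 p.2.1.2 U ∂μ =
      (plaquettesTouching {e₀}).card * ∫ U, plaquetteObs ρ 0 0 1 U ∂μ := by
    rw [integral_finsetSum _ fun p _ => ?_]
    · rw [Finset.sum_congr rfl fun p _ =>
        PlaquettePositivity.integral_plaquetteObs_eq ρ hρ.1 hd hμ p.1 (ne_of_lt p.2.2),
        Finset.sum_const, nsmul_eq_mul]
    · exact (continuous_plaquetteObs ρ hρ.1 _ _ _).integrable_of_hasCompactSupport (HasCompactSupport.of_compactSpace _)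
  have hce : ((plaquettesTouching {e₀}).card : ℝ) = 2 * ((d : ℝ) - 1) := by
    rw [Balaban1983to89.Sufficient.card_plaquettesTouching_singleton e₀]
    have h1 : 1 ≤ d := by omega
    push_cast [Nat.cast_sub h1]
    ring
  rw [hsum, hce] at h
  have hdpos : (0 : ℝ) < 2 * ((d : ℝ) - 1) := by
    have : (2 : ℝ) ≤ d := by exact_mod_cast hd
    linarith
  have h' : 2 * ((d : ℝ) - 1) * ∫ U, plaquetteObs ρ 0 0 1 U ∂μ ≤
      2 * ((d : ℝ) - 1) * (β * Real.exp (4 * ((d : ℝ) - 1) * N * β) * PlaquetteLowerBound.charVariance ρ *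
        (1 + (2 * ((d : ℝ) - 1) - 1) * (Real.exp (4 * ((d : ℝ) - 1) * N * β) - 1))) := by
    linarith
  exact le_of_mul_le_mul_left h' hdpos

/-- ★ **`W_μ(1,1) ≤ u · e^{D}(1 + (2(d−1) − 1)(e^{D} − 1))`**, `u = βV₀/N`, `D = 4(d−1)Nβ`, for every `G ≅ SU(N)`, `N ≥ 2`, `d ≥ 2`,
`β ≥ 0` and every infinite-volume limit state. [folklore] -/
theorem rectExpectation_one_one_le (hρ : IsSpecialUnitaryModel ρ) (hN : 2 ≤ N) (hd : 2 ≤ d) {β : ℝ} (hβ : 0 ≤ β)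
    {μ : Measure (LGConfig d G)} (hμ : μ ∈ infiniteVolumeLimitPoints ρ β) :
    rectExpectation μ (fun g => normalisedCharacter N (ρ g)) 0 1 1 1 ≤
      β * PlaquetteLowerBound.charVariance ρ / N * Real.exp (4 * ((d : ℝ) - 1) * N * β) *
        (1 + (2 * ((d : ℝ) - 1) - 1) * (Real.exp (4 * ((d : ℝ) - 1) * N * β) - 1)) := by
  have h := integral_plaquetteObs_le ρ hρ hN hd hβ hμ
  have hN0 : (0 : ℝ) < N := by exact_mod_cast (show 0 < N by omega)
  have hW : rectExpectation μ (fun g => normalisedCharacter N (ρ g)) 0 1 1 1 = (N : ℝ)⁻¹ * ∫ U, plaquetteObs ρ 0 0 1 U ∂μ := by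
    have hline : ∀ (U : LGConfig d G) (i : Fin d) (x : Literature.Probability.LatticeModels.Site d),
        walkHolonomy U (lineWalk i 1 x) = U (x, i) := fun U i x => by
      rw [lineWalk, walkHolonomy_cons, walkHolonomy_copy, lineWalk, walkHolonomy_copy, walkHolonomy_nil, mul_one,
        dartHolonomy_add_single]
    have hhol : ∀ U : LGConfig d G, walkHolonomy U (rectWalk 0 0 1 1 1) = plaquetteHolonomyZd U 0 0 1 := fun U => by
      simp only [rectWalk, walkHolonomy_append, walkHolonomy_copy, walkHolonomy_reverse, hline, Nat.cast_one,
        plaquetteHolonomyZd, mul_assoc]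
    unfold rectExpectation loopExpectation wilsonLoopObs
    simp only [normalisedCharacter, plaquetteObs, hhol]
    rw [integral_const_mul]
  rw [hW]
  have e : β * PlaquetteLowerBound.charVariance ρ / N * Real.exp (4 * ((d : ℝ) - 1) * N * β) *
      (1 + (2 * ((d : ℝ) - 1) - 1) * (Real.exp (4 * ((d : ℝ) - 1) * N * β) - 1)) =
      (N : ℝ)⁻¹ * (β * Real.exp (4 * ((d : ℝ) - 1) * N * β) * PlaquetteLowerBound.charVariance ρ *
        (1 + (2 * ((d : ℝ) - 1) - 1) * (Real.exp (4 * ((d : ℝ) - 1) * N * β) - 1))) := by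
    field_simp
  rw [e]
  exact mul_le_mul_of_nonneg_left h (by positivity)

/-- ★★ **`W_μ(1,1) ≤ u · e^{8(d−1)²Nβ}`** with `u = βV₀/N`, for every `G ≅ SU(N)`, `N ≥ 2`, `d ≥ 2`, `β ≥ 0` and every infinite-volume
limit state (Bernoulli: `1 + k(e^{D} − 1) ≤ e^{kD}`). [folklore] -/
theorem rectExpectation_one_one_le_exp (hρ : IsSpecialUnitaryModel ρ) (hN : 2 ≤ N) (hd : 2 ≤ d) {β : ℝ} (hβ : 0 ≤ β)
    {μ : Measure (LGConfig d G)} (hμ : μ ∈ infiniteVolumeLimitPoints ρ β) :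
    rectExpectation μ (fun g => normalisedCharacter N (ρ g)) 0 1 1 1 ≤
      β * PlaquetteLowerBound.charVariance ρ / N * Real.exp (8 * ((d : ℝ) - 1) ^ 2 * N * β) := by
  refine (rectExpectation_one_one_le ρ hρ hN hd hβ hμ).trans ?_
  set D : ℝ := 4 * ((d : ℝ) - 1) * N * β with hD
  have hN0 : (0 : ℝ) < N := by exact_mod_cast (show 0 < N by omega)
  have hV := (PlaquetteLowerBound.charVariance_pos ρ hρ.1 (by omega)).le
  -- Bernoulli with `k = 2d - 3`
  have hk : ((2 * d - 3 : ℕ) : ℝ) = 2 * ((d : ℝ) - 1) - 1 := by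
    have h3 : 3 ≤ 2 * d := by omega
    push_cast [Nat.cast_sub h3]; ring
  have hbern : 1 + (2 * ((d : ℝ) - 1) - 1) * (Real.exp D - 1) ≤ Real.exp (((2 * d - 3 : ℕ) : ℝ) * D) := by
    have h := one_add_mul_le_pow (a := Real.exp D - 1) (by linarith [Real.exp_pos D]) (2 * d - 3)
    rw [hk] at h
    rw [Real.exp_nat_mul]
    have e : 1 + (Real.exp D - 1) = Real.exp D := by ring
    rw [e] at h
    exact h
  have hexp : Real.exp (8 * ((d : ℝ) - 1) ^ 2 * N * β) = Real.exp D * Real.exp (((2 * d - 3 : ℕ) : ℝ) * D) := by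
    rw [← Real.exp_add, hk, hD]; ring_nf
  rw [hexp]
  have hu : 0 ≤ β * PlaquetteLowerBound.charVariance ρ / N * Real.exp D := by positivity
  calc β * PlaquetteLowerBound.charVariance ρ / N * Real.exp D * (1 + (2 * ((d : ℝ) - 1) - 1) * (Real.exp D - 1))
      ≤ β * PlaquetteLowerBound.charVariance ρ / N * Real.exp D * Real.exp (((2 * d - 3 : ℕ) : ℝ) * D) :=
        mul_le_mul_of_nonneg_left hbern hu
    _ = β * PlaquetteLowerBound.charVariance ρ / N * (Real.exp D * Real.exp (((2 * d - 3 : ℕ) : ℝ) * D)) := by ring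

/-- ★★ **THE MEAN-PLAQUETTE LAW, abstract form**: for every `G ≅ SU(N)`, `N ≥ 2`, `d ≥ 2`, every `β > 0` and every infinite-volume
limit state, `log u − 2(d−1)(2d+1)Nβ ≤ log W_μ(1,1) ≤ log u + 8(d−1)²Nβ` with `u = βV₀/N`. [folklore] -/
theorem log_rectExpectation_two_sided (hρ : IsSpecialUnitaryModel ρ) (hN : 2 ≤ N) (hd : 2 ≤ d) {β : ℝ} (hβ : 0 < β)
    {μ : Measure (LGConfig d G)} (hμ : μ ∈ infiniteVolumeLimitPoints ρ β) :
    Real.log (β * PlaquetteLowerBound.charVariance ρ / N) - 2 * ((d : ℝ) - 1) * (2 * (d : ℝ) + 1) * N * β ≤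
        Real.log (rectExpectation μ (fun g => normalisedCharacter N (ρ g)) 0 1 1 1) ∧
      Real.log (rectExpectation μ (fun g => normalisedCharacter N (ρ g)) 0 1 1 1) ≤
        Real.log (β * PlaquetteLowerBound.charVariance ρ / N) + 8 * ((d : ℝ) - 1) ^ 2 * N * β := by
  have hlow := StringTensionExplicit.rectExpectation_one_one_ge_linear ρ hρ hN hd hβ.le hμ
  have hup := rectExpectation_one_one_le_exp ρ hρ hN hd hβ.le hμ
  have hV := PlaquetteLowerBound.charVariance_pos ρ hρ.1 (by omega)
  have hN0 : (0 : ℝ) < N := by exact_mod_cast (show 0 < N by omega)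
  have hu : 0 < β * PlaquetteLowerBound.charVariance ρ / N := by positivity
  have hlowpos : 0 < β * PlaquetteLowerBound.charVariance ρ / N * Real.exp (-(2 * ((d : ℝ) - 1) * (2 * (d : ℝ) + 1) * N * β)) := by
    positivity
  have hWpos : 0 < rectExpectation μ (fun g => normalisedCharacter N (ρ g)) 0 1 1 1 := lt_of_lt_of_le hlowpos hlow
  constructor
  · have h := Real.log_le_log hlowpos hlow
    rw [Real.log_mul hu.ne' (Real.exp_pos _).ne', Real.log_exp] at h
    linarith
  · have h := Real.log_le_log hWpos hup
    rw [Real.log_mul hu.ne' (Real.exp_pos _).ne', Real.log_exp] at h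
    linarith

end Model

/-! ### `SU(2)`: `log W_μ(1,1) = log(β_W/4) + O(β_W)` at every coupling, every limit state -/

variable {n N : ℕ}

/-- ★★ **SU(2), dimension `n + 1 ≥ 2`, THE MEAN-PLAQUETTE LAW**: for every `β_W > 0` and every infinite-volume limit state at tree
coupling `β_W/2`, `log(β_W/4) − 2n(2n+3)β_W ≤ log W_μ(1,1) ≤ log(β_W/4) + 8n²β_W` (`β_W/4 = u`, the first term of
`W(1,1) = I₂(β_W)/I₁(β_W)`; `V₀(SU(2)) = 1`). [folklore] -/
theorem su2_log_plaquette_two_sided (hn : 1 ≤ n) {βW : ℝ} (hβ : 0 < βW) {μ : Measure (LGConfig (n + 1) (SUN 2))}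
    (hμ : haveI : NeZero (n + 1) := ⟨by omega⟩; μ ∈ infiniteVolumeLimitPoints (fundamentalRep (Fin 2)) (βW / 2)) :
    haveI : NeZero (n + 1) := ⟨by omega⟩
    Real.log (βW / 4) - 2 * n * (2 * n + 3) * βW ≤
        Real.log (rectExpectation μ (fun g => normalisedCharacter 2 (fundamentalRep (Fin 2) g)) 0 1 1 1) ∧
      Real.log (rectExpectation μ (fun g => normalisedCharacter 2 (fundamentalRep (Fin 2) g)) 0 1 1 1) ≤
        Real.log (βW / 4) + 8 * n ^ 2 * βW := by
  haveI : NeZero (n + 1) := ⟨by omega⟩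
  have hρ := TorusAreaLaw.isSpecialUnitaryModel_fundamentalRep 2
  have h := log_rectExpectation_two_sided (d := n + 1) (fundamentalRep (Fin 2)) hρ le_rfl (by omega)
    (by positivity : 0 < βW / 2) hμ
  rw [HaarSecondMoments.charVariance_su2] at h
  have hd : ((n + 1 : ℕ) : ℝ) - 1 = n := by push_cast; ring
  have hd' : (2 : ℝ) * ((n + 1 : ℕ) : ℝ) + 1 = 2 * n + 3 := by push_cast; ring
  rw [hd, hd'] at h
  have e1 : βW / 2 * 1 / ((2 : ℕ) : ℝ) = βW / 4 := by push_cast; ring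
  have e2 : 2 * (n : ℝ) * (2 * n + 3) * (2 : ℕ) * (βW / 2) = 2 * n * (2 * n + 3) * βW := by push_cast; ring
  have e3 : 8 * (n : ℝ) ^ 2 * (2 : ℕ) * (βW / 2) = 8 * n ^ 2 * βW := by push_cast; ring
  rw [e1, e2, e3] at h
  exact h

/-- ★★ **SU(2), `d = 4`: `−54β_W ≤ log W_μ(1,1) − log(β_W/4) ≤ 72β_W`** for every infinite-volume limit state at EVERY `β_W > 0`.
[folklore] -/
theorem su2_log_plaquette_two_sided_dim4 {βW : ℝ} (hβ : 0 < βW) {μ : Measure (LGConfig 4 (SUN 2))}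
    (hμ : μ ∈ infiniteVolumeLimitPoints (fundamentalRep (Fin 2)) (βW / 2)) :
    -(54 * βW) ≤ Real.log (rectExpectation μ (fun g => normalisedCharacter 2 (fundamentalRep (Fin 2) g)) 0 1 1 1) - Real.log (βW / 4) ∧
      Real.log (rectExpectation μ (fun g => normalisedCharacter 2 (fundamentalRep (Fin 2) g)) 0 1 1 1) - Real.log (βW / 4) ≤
        72 * βW := by
  obtain ⟨h1, h2⟩ := su2_log_plaquette_two_sided (n := 3) (by norm_num) hβ hμ
  push_cast at h1 h2
  constructor <;> linarith

/-- ★ **SU(2), `d = 4`: `|log W_μ(1,1) − log(β_W/4)| ≤ 72β_W`** at every `β_W > 0`, every infinite-volume limit state. [folklore] -/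
theorem su2_abs_log_plaquette_sub_log_le_dim4 {βW : ℝ} (hβ : 0 < βW) {μ : Measure (LGConfig 4 (SUN 2))}
    (hμ : μ ∈ infiniteVolumeLimitPoints (fundamentalRep (Fin 2)) (βW / 2)) :
    |Real.log (rectExpectation μ (fun g => normalisedCharacter 2 (fundamentalRep (Fin 2) g)) 0 1 1 1) - Real.log (βW / 4)| ≤
      72 * βW := by
  obtain ⟨h1, h2⟩ := su2_log_plaquette_two_sided_dim4 hβ hμ
  rw [abs_le]
  constructor <;> linarith

/-- ★ **SU(2), `d = 3`: `−28β_W ≤ log W_μ(1,1) − log(β_W/4) ≤ 32β_W`** at every `β_W > 0`, every infinite-volume limit state.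
[folklore] -/
theorem su2_log_plaquette_two_sided_dim3 {βW : ℝ} (hβ : 0 < βW) {μ : Measure (LGConfig 3 (SUN 2))}
    (hμ : μ ∈ infiniteVolumeLimitPoints (fundamentalRep (Fin 2)) (βW / 2)) :
    -(28 * βW) ≤ Real.log (rectExpectation μ (fun g => normalisedCharacter 2 (fundamentalRep (Fin 2) g)) 0 1 1 1) - Real.log (βW / 4) ∧
      Real.log (rectExpectation μ (fun g => normalisedCharacter 2 (fundamentalRep (Fin 2) g)) 0 1 1 1) - Real.log (βW / 4) ≤
        32 * βW := by
  obtain ⟨h1, h2⟩ := su2_log_plaquette_two_sided (n := 2) (by norm_num) hβ hμ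
  push_cast at h1 h2
  constructor <;> linarith

/-- ★★ **SU(2), `d = 4`: `W_μ(1,1)/(β_W/4) → 1` as `β_W → 0`, UNIFORMLY over the infinite-volume limit states**:
`∀ ε > 0, ∃ β₀ > 0, ∀ β_W ∈ (0, β₀], ∀ μ, |W_μ(1,1)/(β_W/4) − 1| ≤ ε` (`β₀ = log(1 + ε)/72`). [folklore] -/
theorem su2_plaquette_ratio_limit_dim4 (ε : ℝ) (hε : 0 < ε) :
    ∃ β₀ : ℝ, 0 < β₀ ∧ ∀ βW : ℝ, 0 < βW → βW ≤ β₀ →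
      ∀ μ ∈ infiniteVolumeLimitPoints (d := 4) (fundamentalRep (Fin 2)) (βW / 2),
        |rectExpectation μ (fun g => normalisedCharacter 2 (fundamentalRep (Fin 2) g)) 0 1 1 1 / (βW / 4) - 1| ≤ ε := by
  have hL : 0 < Real.log (1 + ε) := Real.log_pos (by linarith)
  refine ⟨Real.log (1 + ε) / 72, by positivity, fun βW hβ hβ0 μ hμ => ?_⟩
  set W : ℝ := rectExpectation μ (fun g => normalisedCharacter 2 (fundamentalRep (Fin 2) g)) 0 1 1 1 with hWdef
  obtain ⟨h1, h2⟩ := su2_log_plaquette_two_sided_dim4 hβ hμ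
  have hρ := TorusAreaLaw.isSpecialUnitaryModel_fundamentalRep 2
  have hWpos : 0 < W := WilsonStringTension.rectExpectation_pos (d := 4) (fundamentalRep (Fin 2)) hρ le_rfl (by norm_num)
    (by positivity : 0 < βW / 2) hμ 1 1
  have hu : 0 < βW / 4 := by positivity
  have h72 : 72 * βW ≤ Real.log (1 + ε) := by
    have := mul_le_mul_of_nonneg_left hβ0 (by norm_num : (0 : ℝ) ≤ 72)
    linarith
  -- `W/u = exp(log W − log u)` lies in `[e^{−54β_W}, e^{72β_W}] ⊆ [2 − (1+ε), 1 + ε]`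
  have hratio : W / (βW / 4) = Real.exp (Real.log W - Real.log (βW / 4)) := by
    rw [Real.exp_sub, Real.exp_log hWpos, Real.exp_log hu]
  rw [hratio, abs_le]
  constructor
  · -- lower: `exp(x) ≥ 1 + x ≥ 1 − 54β_W ≥ 1 − log(1+ε) ≥ 1 − ε`
    have hx := Real.add_one_le_exp (Real.log W - Real.log (βW / 4))
    have hlog_le : Real.log (1 + ε) ≤ ε := by
      have := Real.log_le_sub_one_of_pos (by linarith : (0 : ℝ) < 1 + ε)
      linarith
    linarith
  · -- upper: `exp(x) ≤ exp(72β_W) ≤ exp(log(1+ε)) = 1 + ε`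
    have hx : Real.exp (Real.log W - Real.log (βW / 4)) ≤ Real.exp (Real.log (1 + ε)) :=
      Real.exp_le_exp.2 (by linarith)
    rw [Real.exp_log (by linarith)] at hx
    linarith

/-! ### Every `N ≥ 3` (`V₀ = 1/2`, `u = β/(2N) = β_W/(2N²)`) -/

/-- ★ **Every `N ≥ 3`, dimension `n + 1 ≥ 2`: `log(β/(2N)) − 2n(2n+3)Nβ ≤ log W_μ(1,1) ≤ log(β/(2N)) + 8n²Nβ`** for every `β > 0` and
every infinite-volume limit state (`β/(2N) = β_W/(2N²) = u`, the first term of the `SU(N)` strong-coupling series of `W(1,1)`). [folklore] -/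
theorem suN_log_plaquette_two_sided (hN : 3 ≤ N) (hn : 1 ≤ n) {β : ℝ} (hβ : 0 < β) {μ : Measure (LGConfig (n + 1) (SUN N))}
    (hμ : haveI : NeZero (n + 1) := ⟨by omega⟩; μ ∈ infiniteVolumeLimitPoints (fundamentalRep (Fin N)) β) :
    haveI : NeZero (n + 1) := ⟨by omega⟩
    Real.log (β / (2 * N)) - 2 * n * (2 * n + 3) * N * β ≤
        Real.log (rectExpectation μ (fun g => normalisedCharacter N (fundamentalRep (Fin N) g)) 0 1 1 1) ∧
      Real.log (rectExpectation μ (fun g => normalisedCharacter N (fundamentalRep (Fin N) g)) 0 1 1 1) ≤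
        Real.log (β / (2 * N)) + 8 * n ^ 2 * N * β := by
  haveI : NeZero (n + 1) := ⟨by omega⟩
  have hρ := TorusAreaLaw.isSpecialUnitaryModel_fundamentalRep N
  have h := log_rectExpectation_two_sided (d := n + 1) (fundamentalRep (Fin N)) hρ (by omega) (by omega) hβ hμ
  rw [HaarSecondMoments.charVariance_suN hN] at h
  have hd : ((n + 1 : ℕ) : ℝ) - 1 = n := by push_cast; ring
  have hd' : (2 : ℝ) * ((n + 1 : ℕ) : ℝ) + 1 = 2 * n + 3 := by push_cast; ring
  rw [hd, hd'] at h
  have hN0 : (0 : ℝ) < N := by exact_mod_cast (show 0 < N by omega)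
  have e1 : β * (1 / 2) / (N : ℝ) = β / (2 * N) := by field_simp
  rw [e1] at h
  exact h

/-- ★ **Every `N ≥ 3`, `d = 4`: `−54Nβ ≤ log W_μ(1,1) − log(β/(2N)) ≤ 72Nβ`** at every `β > 0`, every infinite-volume limit state.
[folklore] -/
theorem suN_log_plaquette_two_sided_dim4 (hN : 3 ≤ N) {β : ℝ} (hβ : 0 < β) {μ : Measure (LGConfig 4 (SUN N))}
    (hμ : μ ∈ infiniteVolumeLimitPoints (fundamentalRep (Fin N)) β) :
    -(54 * N * β) ≤ Real.log (rectExpectation μ (fun g => normalisedCharacter N (fundamentalRep (Fin N) g)) 0 1 1 1) -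
        Real.log (β / (2 * N)) ∧
      Real.log (rectExpectation μ (fun g => normalisedCharacter N (fundamentalRep (Fin N) g)) 0 1 1 1) -
        Real.log (β / (2 * N)) ≤ 72 * N * β := by
  obtain ⟨h1, h2⟩ := suN_log_plaquette_two_sided (n := 3) hN (by norm_num) hβ hμ
  push_cast at h1 h2
  constructor <;> linarith

end PlaquetteLaw

end Summit.Ventures.YMGap.RobustBall
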